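/-
Copyright (c) 2026 the pub-hodgecm-mathlib formalisation cell (harness21).  Prover seat hodgecm-mathlib-R90-C10-p08 (g0) (free S1 hand), HCML SLAB R90-TF,
section S6 «Ch. 14.1–14.5 stable trace formula» (base `R90-C14`), S6 WAVE 3 OPEN CARD W3-f (R90-C14-plan (g0), R90 bus 2026-09-04T21:29:46Z).  2026-09-04.
-/
import Literature.NumberTheory.Automorphic.HyperspecialUnitarySatakeTransformAdicCompletion   -- ★ `unitaryHeckeEigencharacterAdic(_apply)`, `unitarySatakeTransformAdic_eq`, `unramifiedLocalConjDatum_localConjUniformizer`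
import Literature.NumberTheory.Automorphic.HyperspecialUnitarySatakeIsomorphismAdicCompletion  -- ★ `exists_galAdicCompletionMap_ne` (`σ_w ≠ id` at an inert place)
import Literature.NumberTheory.Automorphic.UnitaryRankOneUnramifiedCharacters                  -- ★ `UnramifiedLocalConjDatum.exists_generator_two`, `laurentEvalAt_single_line_add` (`ℋ(U(2), K₀) = ℂ[T₁]`, `ev_{(z,1)} X = z + z⁻¹`)
import Mathlib.LinearAlgebra.Lagrange                                                         -- Mathlib `Lagrange.basis`, `eval_basis_self`, `eval_basis_of_ne`
import HarnessLib

/-!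
# R90 · S6 «Ch. 14.1–14.5 stable trace formula» — WAVE 3 card W3-f: unramified HECKE EIGENCHARACTERS of `U(J₀,2)(E_w)` with distinct Satake traces
# are LINEARLY INDEPENDENT (`Theorems/R90S6HeckeEigencharactersSeparateTwo.lean`)

Cell `hodgecm-mathlib`, crux H413 (`stmt-HodgeConjecture-24833`), route of record `HCCMUnconditional`; programme R90-TF, section S6 (base `R90-C14`),
seat R90-C10-p08 (g0) (free S1 hand, «▶ taking W3-f» 21:33Z); S6 WAVE 3 OPEN CARD W3-f of the sheet
`R90/R90-C14-plan/g0/S6_wave3ef_targets.v1.R90-C14-plan-g0.lean` f4d26f1db6a7ba34 :36–:43 (signature token-identical, namespace segment `.Wave3` dropped;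
AUDIT S6#W3 e∕f CLEAN 21:30:09Z).  Helper lane `--supports stmt-HodgeConjecture-24833 --as helper`; THEOREMS ONLY (no definition, no instance, no notation,
no named fact, no `sorry`); imports = ★ Literature Satake files + Mathlib `Lagrange` + HarnessLib (no Lines import).

THE PRINT [Rogawski1990, §14.5 pp. 232–236: the comparison identity holds «for all `f = ⊗ f_v` with `f_w` in the Hecke algebra» and the eigenvalue packets are
separated by varying `f_w`]; [CartierCorvallis1979, §IV Thm. 4.1, Cor. 4.2] (`ℋ(G, K) ≅ ℂ[Λ]^W`; in relative rank one `= ℂ[X]`); linear independence of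
characters.  For `U(J₀,2)(E_w)` at an inert unramified `w` the spherical Hecke algebra is `ℂ[T₁]` with `𝒮_w(T₁) = x^{(1,-1)} + x^{(-1,1)}`
(★ `UnramifiedLocalConjDatum.exists_generator_two`) and `λ_{(z,1)}(Q(T₁)) = Q(z + z⁻¹)` (`λ_β = ev_β ∘ 𝒮_w`, ★ `laurentEvalAt_single_line_add`).  Given a
finite relation `Σ_i c_i λ_{(z_i,1)} = 0` on `ℋ` with pairwise distinct traces `s_i = z_i + z_i⁻¹`, test it on `Q_j(T₁)` for the LAGRANGE polynomial `Q_j` at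
the nodes `s` (Mathlib `Lagrange.basis univ s j`: `Q_j(s_i) = δ_{ij}`, ★ `Lagrange.eval_basis_self` ∕ `eval_basis_of_ne`): `0 = Σ_i c_i Q_j(s_i) = c_j`.
* private `unitaryHeckeEigencharacterAdic_two_aeval'`, `exists_generator_unitaryHeckeAlgebraAdic_two'` — the `N = 2` computation `λ_{(z,1)}(Q(T₁)) = Q(z + z⁻¹)`
  and the adic packaging of ★ `exists_generator_two` (private twins of R90-C14-p03's W3-b pair, which is not yet in the tree; no unlanded bytes imported);
* **`hecke_eigencharacters_separate_two`** — W3-f.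
HONEST LABEL: local spherical Hecke algebra bookkeeping; proves no printed global statement.  HC_CM is proved only modulo the 7 printed
citations (2 remaining named inputs: hLiu418 = stmt-HodgeConjecture-24832, h413 = stmt-HodgeConjecture-24833) until rung 0 closes; count-neutral helper.

## Tree search
★ `exists_generator_two`, `laurentEvalAt_single_line_add`, `unitaryHeckeEigencharacterAdic_apply`, `unitarySatakeTransformAdic_eq`,
`unramifiedLocalConjDatum_localConjUniformizer`, `exists_galAdicCompletionMap_ne`, `isHeckeTriple_unitaryInt_adicCompletion`, `finite_residueField_adicCompletion`;
★ `R90S6HeckeEigenpolyThreeExists` (the `N = 3` twin, p862233); Mathlib `Lagrange.basis`, `Lagrange.eval_basis_self`, `Lagrange.eval_basis_of_ne`,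
`Polynomial.aeval_algHom_apply`, `Polynomial.coe_aeval_eq_eval`, `Finset.sum_ite_eq'`.  Dedup: `rg "hecke_eigencharacters_separate_two"` — only the sheet (R90/, not in tree).

## References
* [Rogawski1990] J. D. Rogawski, *Automorphic Representations of Unitary Groups in Three Variables*, Ann. of Math. Stud. 123 (1990), §4.5 p. 50; §14.5 pp. 232–236.
* [CartierCorvallis1979] P. Cartier, *Representations of 𝔭-adic groups: a survey*, PSPM 33.1 (1979), §IV (4.2)–(4.4), Thm. 4.1, Cor. 4.2.
* [Minguez2011] A. Mínguez, *Unramified representations of unitary groups* (2011), §4.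
-/

set_option autoImplicit false
-- the mandated namespace repeats the single-problem summit's segment (`HodgeConjecture.HodgeConjecture`)
set_option linter.dupNamespace false

noncomputable section

open NumberField IsDedekindDomain Polynomial
open Literature.NumberTheory.Automorphic Literature.NumberTheory.Automorphic.HermitianLattice Literature.NumberTheory.Automorphic.UnitaryGroup

namespace Summit.HodgeConjecture.HodgeConjecture.R90.S6

variable {F E : Type} [Field F] [NumberField F] [Field E] [NumberField E] [Algebra F E] [Algebra.IsQuadraticExtension F E]
  (c : E ≃ₐ[F] E) (hc1 : c ≠ 1) (v : HeightOneSpectrum (𝓞 F)) (w : PlacesOver E v) (hw : c • w.1 = w.1)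
  (hv : Algebra.IsUnramifiedIn (𝓞 E) v.asIdeal)

/-! ## §1 Private: `ℋ(U(J₀,2)(E_w), K₀) = ℂ[T₁]` and `λ_{(z,1)}(Q(T₁)) = Q(z + z⁻¹)` -/

/-- The exponent line of `U(2)`, `ℓ_m = (m, -m)`, is additive. [folklore] -/
private theorem line_two_add (a b : ℤ) :
    (fun i : Fin 2 => (a + b) * (1 - 2 * (i : ℕ))) = (fun i : Fin 2 => a * (1 - 2 * (i : ℕ))) + fun i : Fin 2 => b * (1 - 2 * (i : ℕ)) := by
  funext i; simp only [Pi.add_apply]; ring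

/-- `λ_{(z,1)}(Q(T₁)) = Q(z + z⁻¹)` on `ℋ(U(J₀,2)(E_w), K₀)` for any `T₁` with `𝒮_w(T₁) = x^{(1,-1)} + x^{(-1,1)}` (private twin of R90-C14-p03's
`unitaryHeckeEigencharacterAdic_two_aeval`). [cite: CartierCorvallis1979, §IV (4.2)–(4.4)] -/
private theorem unitaryHeckeEigencharacterAdic_two_aeval'
    {T₁ : heckeAlgebra ℂ ↥(unitaryGroupOfForm (galAdicCompletionMap (L := E) c hw) ((StdForm.antidiagonal 2).over (w.1.adicCompletion E)))
      (unitaryInt (galAdicCompletionMap (L := E) c hw) ((StdForm.antidiagonal 2).over (w.1.adicCompletion E)))}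
    (hT₁ : unitarySatakeTransformAdic c hc1 v w hw hv T₁ =
      AddMonoidAlgebra.single (fun i : Fin 2 => (1 : ℤ) * (1 - 2 * (i : ℕ))) (1 : ℂ) +
        AddMonoidAlgebra.single (fun i : Fin 2 => (-1 : ℤ) * (1 - 2 * (i : ℕ))) 1)
    (Q : ℂ[X]) (z : ℂˣ) :
    unitaryHeckeEigencharacterAdic c hc1 v w hw hv ![z, 1] (aeval T₁ Q) = Q.eval ((z : ℂ) + (z : ℂ)⁻¹) := by
  rw [← aeval_algHom_apply, unitaryHeckeEigencharacterAdic_apply, hT₁,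
    laurentEvalAt_single_line_add (ℓ := fun m (i : Fin 2) => m * (1 - 2 * (i : ℕ))) line_two_add, coe_aeval_eq_eval]
  congr 1
  have hz : (∏ i : Fin 2, (((![z, 1] : Fin 2 → ℂˣ) i : ℂ) ^ ((1 : ℤ) * (1 - 2 * ((i : ℕ) : ℤ))))) = (z : ℂ) := by
    rw [Fin.prod_univ_two]
    simp
  rw [hz]

/-- `ℋ(U(J₀,2)(E_w), K₀) = ℂ[T₁]` at an inert unramified place: a generator `T₁` with `𝒮_w(T₁) = x^{(1,-1)} + x^{(-1,1)}` exists (private adic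
packaging of ★ `exists_generator_two`). [cite: CartierCorvallis1979, §IV Thm. 4.1] [cite: Minguez2011, §4] -/
private theorem exists_generator_unitaryHeckeAlgebraAdic_two' :
    ∃ T₁ : heckeAlgebra ℂ ↥(unitaryGroupOfForm (galAdicCompletionMap (L := E) c hw) ((StdForm.antidiagonal 2).over (w.1.adicCompletion E)))
        (unitaryInt (galAdicCompletionMap (L := E) c hw) ((StdForm.antidiagonal 2).over (w.1.adicCompletion E))),
      unitarySatakeTransformAdic c hc1 v w hw hv T₁ =
          AddMonoidAlgebra.single (fun i : Fin 2 => (1 : ℤ) * (1 - 2 * (i : ℕ))) (1 : ℂ) +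
            AddMonoidAlgebra.single (fun i : Fin 2 => (-1 : ℤ) * (1 - 2 * (i : ℕ))) 1 ∧
      ∀ T, ∃ P : ℂ[X], aeval T₁ P = T := by
  haveI := finite_residueField_adicCompletion E w.1
  haveI := isHeckeTriple_unitaryInt_adicCompletion c v w hw ((StdForm.antidiagonal 2).over (w.1.adicCompletion E))
  obtain ⟨T₁, hT₁, hgen⟩ := (unramifiedLocalConjDatum_localConjUniformizer c hc1 v w hw hv).exists_generator_two
    (exists_galAdicCompletionMap_ne c hc1 v w hw)
  refine ⟨T₁, ?_, hgen⟩
  rw [unitarySatakeTransformAdic_eq c hc1 v w hw hv (unramifiedLocalConjDatum_localConjUniformizer c hc1 v w hw hv)]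
  exact hT₁

/-! ## §2 W3-f -/

/-- **W3-f — unramified Hecke eigencharacters of `U(J₀,2)(E_w)` with pairwise distinct Satake traces are linearly independent**
[Rogawski1990, §14.5 pp. 232–236; CartierCorvallis1979 §IV Thm. 4.1, Cor. 4.2]: if `Σ_i c_i · λ_{(z_i,1)}(φH) = 0` for EVERY `φH ∈ ℋ(U(J₀,2)(E_w), K₀)` and
the traces `z_i + z_i⁻¹` are pairwise distinct, then every `c_i = 0` — test the relation on `Q_j(T₁)` with `Q_j` the Lagrange polynomial at the nodes
`s_i = z_i + z_i⁻¹` (`λ_{(z_i,1)}(Q_j(T₁)) = Q_j(s_i) = δ_{ij}`).  (Sheet `S6_wave3ef_targets.v1` :36–:43 token-for-token; supply lemma for the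
«linear independence of Hecke characters» step of the (14.5.1) Hecke variation.)
[cite: Rogawski1990, §14.5 pp. 232–236] [cite: CartierCorvallis1979, §IV Thm. 4.1, Cor. 4.2] [cite: Minguez2011, §4] -/
theorem hecke_eigencharacters_separate_two {n : ℕ} (z : Fin n → ℂˣ) (coef : Fin n → ℂ)
    (hz : ∀ i j : Fin n, i ≠ j → (z i : ℂ) + (z i : ℂ)⁻¹ ≠ (z j : ℂ) + (z j : ℂ)⁻¹)
    (hrel : ∀ φH : heckeAlgebra ℂ ↥(unitaryGroupOfForm (galAdicCompletionMap (L := E) c hw) ((StdForm.antidiagonal 2).over (w.1.adicCompletion E)))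
        (unitaryInt (galAdicCompletionMap (L := E) c hw) ((StdForm.antidiagonal 2).over (w.1.adicCompletion E))),
      ∑ i : Fin n, coef i * unitaryHeckeEigencharacterAdic c hc1 v w hw hv ![z i, 1] φH = 0) :
    ∀ i : Fin n, coef i = 0 := by
  classical
  obtain ⟨T₁, hT₁, -⟩ := exists_generator_unitaryHeckeAlgebraAdic_two' c hc1 v w hw hv
  -- the nodes `s_i = z_i + z_i⁻¹`, pairwise distinct
  set s : Fin n → ℂ := fun i => (z i : ℂ) + (z i : ℂ)⁻¹ with hs
  have hinj : Set.InjOn s (Finset.univ : Finset (Fin n)) := by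
    intro i _ j _ hij
    by_contra hne
    exact hz i j hne hij
  intro j
  -- test the relation on the Lagrange polynomial `Q_j` at the nodes: `λ_{(z_i,1)}(Q_j(T₁)) = Q_j(s_i) = δ_{ij}`
  have h := hrel (aeval T₁ (Lagrange.basis Finset.univ s j))
  simp only [unitaryHeckeEigencharacterAdic_two_aeval' c hc1 v w hw hv hT₁] at h
  have hδ : ∀ i : Fin n, (Lagrange.basis Finset.univ s j).eval ((z i : ℂ) + (z i : ℂ)⁻¹) = if j = i then 1 else 0 := by
    intro i
    change (Lagrange.basis Finset.univ s j).eval (s i) = _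
    split_ifs with hji
    · subst hji
      exact Lagrange.eval_basis_self hinj (Finset.mem_univ j)
    · exact Lagrange.eval_basis_of_ne hji (Finset.mem_univ i)
  simp only [hδ, mul_ite, mul_one, mul_zero, Finset.sum_ite_eq, Finset.mem_univ, if_true] at h
  exact h

end Summit.HodgeConjecture.HodgeConjecture.R90.S6

end
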